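import Mathlib
import Literature.RepresentationTheory.FiniteGroups.KLRGradedCellularBasis

/-!
# `SnSubsetDichotomy.NoThresholdSubsetTriple`, line `klr-graded-polynomial-method`:
# stub `pairDeviation_of_mgf` (bridge M: MGF bound → two-sided deviation count, Chernoff)

The Chernoff bridge for the open stub J′ of the crux stmt-MatrixMultiplication-8302
(`SnSubsetDichotomy.NoThresholdSubsetTriple`): the MGF form of J′ implies its deviation form.

With `X i = TableauPair.degree 2 i = deg₂ S + deg₂ T` and `w i = c₀ − (c₀ − c₁)²` the `2`-weight
of the shape (`cⱼ = TableauPair.content 2 i j`), put `Y i = X i − w i ∈ ℤ`. If for some `C` and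
all small `θ > 0` the two-sided moment generating sum satisfies
`∑_i (e^{θ Y i/√n} + e^{−θ Y i/√n}) ≤ 2·n!·e^{C θ² √n}` for large `n`, then
`#{i : n ≤ 100·|Y i|} ≤ n!·e^{−c√n}` for large `n`, with `c = θ/400` for the choice
`θ = min θ₀ (1/(200(|C|+1)))` (so that `Cθ² ≤ θ/200`).

Proof (Chernoff on a finite sum, pure real analysis on an arbitrary `ℤ`-valued function on a
finite type): for `i` with `n ≤ 100|Y i|` one of `±θ Y i/√n` is `≥ θ√n/100` (as `n/√n = √n`),
so `e^{θ√n/100} ≤ e^{θ Y i/√n} + e^{−θ Y i/√n}` pointwise; summing,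
`#{…}·e^{θ√n/100} ≤ 2·n!·e^{Cθ²√n} ≤ 2·n!·e^{(θ/200)√n}`, whence
`#{…} ≤ 2·n!·e^{−(θ/200)√n} ≤ n!·e^{−(θ/400)√n}` once `2 ≤ e^{(θ/400)√n}`.
-/

namespace Summit.MatrixMultiplication.MatrixMultiplication.Theorems

open Literature.RepresentationTheory.FiniteGroups (TableauPair KLRGradedCellularBasis residueContent tableauDegree)
open scoped BigOperators

namespace KlrLine

/-- Beyond some `n₁`, `2 ≤ e^{c√n}` (`n₁ = ⌈(log 2 / c)²⌉`). [folklore] -/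
private theorem exists_two_le_exp {c : ℝ} (hc : 0 < c) :
    ∃ n₁ : ℕ, ∀ n : ℕ, n₁ ≤ n → (2 : ℝ) ≤ Real.exp (c * Real.sqrt (n : ℝ)) := by
  -- adapted from `exists_six_le_exp` (SnSubsetDichotomyNoThresholdSubsetTripleOfKlrMDP.lean)
  refine ⟨⌈(Real.log 2 / c) ^ 2⌉₊, fun n hn => ?_⟩
  have hn' : (Real.log 2 / c) ^ 2 ≤ (n : ℝ) := (Nat.le_ceil _).trans (by exact_mod_cast hn)
  have h0 : 0 ≤ Real.log 2 / c := by
    have : 0 ≤ Real.log 2 := Real.log_nonneg (by norm_num)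
    positivity
  have hsq : Real.log 2 / c ≤ Real.sqrt (n : ℝ) := by
    rw [← Real.sqrt_sq h0]
    exact Real.sqrt_le_sqrt hn'
  have hlog : Real.log 2 ≤ c * Real.sqrt (n : ℝ) := by
    have := mul_le_mul_of_nonneg_left hsq hc.le
    calc Real.log 2 = c * (Real.log 2 / c) := by field_simp
      _ ≤ c * Real.sqrt (n : ℝ) := this
  calc (2 : ℝ) = Real.exp (Real.log 2) := (Real.exp_log (by norm_num)).symm
    _ ≤ Real.exp (c * Real.sqrt (n : ℝ)) := Real.exp_le_exp.2 hlog

/-- **The Chernoff step, summed pointwise** (any `ℤ`-valued `Z` on a finite type, `θ > 0`):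
`#{i : n ≤ 100|Z i|} · e^{θ√n/100} ≤ ∑_i (e^{θ Z i/√n} + e^{−θ Z i/√n})`. For `i` in the set,
`n ≤ 100·Z i` or `n ≤ −100·Z i`, so (with `n/√n = √n`) `θ√n/100 ≤ ±θ Z i/√n` and
`e^{θ√n/100}` is at most one of the two (positive) summands. [folklore] -/
private theorem card_mul_exp_le_sum {α : Type*} [Fintype α] (Z : α → ℤ) (n : ℕ) {θ : ℝ}
    (hθ : 0 < θ) :
    (Nat.card {i : α // (n : ℤ) ≤ 100 * |Z i|} : ℝ) * Real.exp (θ * Real.sqrt (n : ℝ) / 100) ≤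
      ∑ i, (Real.exp (θ * (Z i : ℝ) / Real.sqrt (n : ℝ)) +
        Real.exp (-(θ * (Z i : ℝ) / Real.sqrt (n : ℝ)))) := by
  classical
  -- `n ≤ 100 y` gives `θ√n/100 ≤ θ y/√n`
  have key : ∀ y : ℝ, (n : ℝ) ≤ 100 * y →
      θ * Real.sqrt (n : ℝ) / 100 ≤ θ * y / Real.sqrt (n : ℝ) := by
    intro y hy
    have hθy : θ * (n : ℝ) ≤ θ * (100 * y) := mul_le_mul_of_nonneg_left hy hθ.le
    calc θ * Real.sqrt (n : ℝ) / 100 = θ * ((n : ℝ) / Real.sqrt (n : ℝ)) / 100 := by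
          rw [Real.div_sqrt]
      _ = θ * (n : ℝ) / 100 / Real.sqrt (n : ℝ) := by ring
      _ ≤ θ * y / Real.sqrt (n : ℝ) := by
          apply div_le_div_of_nonneg_right _ (Real.sqrt_nonneg _)
          linarith
  -- pointwise bound on the set
  have hpt : ∀ i ∈ Finset.univ.filter (fun i : α => (n : ℤ) ≤ 100 * |Z i|),
      Real.exp (θ * Real.sqrt (n : ℝ) / 100) ≤
        Real.exp (θ * (Z i : ℝ) / Real.sqrt (n : ℝ)) +
          Real.exp (-(θ * (Z i : ℝ) / Real.sqrt (n : ℝ))) := by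
    intro i hi
    rw [Finset.mem_filter] at hi
    rcases abs_choice (Z i) with h | h <;> rw [h] at hi
    · have hy : (n : ℝ) ≤ 100 * (Z i : ℝ) := by exact_mod_cast hi.2
      have h2 := Real.exp_le_exp.2 (key _ hy)
      linarith [Real.exp_pos (-(θ * (Z i : ℝ) / Real.sqrt (n : ℝ)))]
    · have hy : (n : ℝ) ≤ 100 * (-(Z i : ℝ)) := by exact_mod_cast hi.2
      have h2 := Real.exp_le_exp.2 (key _ hy)
      have h3 : θ * (-(Z i : ℝ)) / Real.sqrt (n : ℝ) = -(θ * (Z i : ℝ) / Real.sqrt (n : ℝ)) := by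
        ring
      rw [h3] at h2
      linarith [Real.exp_pos (θ * (Z i : ℝ) / Real.sqrt (n : ℝ))]
  -- sum over the set, then over everything
  have h1 := Finset.card_nsmul_le_sum _ _ _ hpt
  rw [nsmul_eq_mul] at h1
  have h2 : ∑ i ∈ Finset.univ.filter (fun i : α => (n : ℤ) ≤ 100 * |Z i|),
      (Real.exp (θ * (Z i : ℝ) / Real.sqrt (n : ℝ)) +
        Real.exp (-(θ * (Z i : ℝ) / Real.sqrt (n : ℝ)))) ≤
      ∑ i, (Real.exp (θ * (Z i : ℝ) / Real.sqrt (n : ℝ)) +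
        Real.exp (-(θ * (Z i : ℝ) / Real.sqrt (n : ℝ)))) :=
    Finset.sum_le_sum_of_subset_of_nonneg (Finset.filter_subset _ _) fun i _ _ => by positivity
  have hcard : (Nat.card {i : α // (n : ℤ) ≤ 100 * |Z i|} : ℝ) =
      ((Finset.univ.filter (fun i : α => (n : ℤ) ≤ 100 * |Z i|)).card : ℝ) := by
    rw [Nat.card_eq_fintype_card, Fintype.card_subtype]
  rw [hcard]
  exact h1.trans h2

/-- **Chernoff: MGF bound → two-sided deviation count**, for an arbitrary family of `ℤ`-valued
functions `Z n` on finite types `α n`. If for some `C`, `θ₀ > 0` and every `0 < θ ≤ θ₀`,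
`∑_i (e^{θ Z n i/√n} + e^{−θ Z n i/√n}) ≤ 2·n!·e^{Cθ²√n}` for large `n`, then for
`θ = min θ₀ (1/(200(|C|+1)))` (so `Cθ² ≤ θ/200`) and `c = θ/400 > 0`,
`#{i : n ≤ 100|Z n i|} ≤ n!·e^{−c√n}` for large `n`:
`#{…}·e^{θ√n/100} ≤ 2·n!·e^{Cθ²√n} ≤ 2·n!·e^{(θ/200)√n}` (`card_mul_exp_le_sum`) and
`2 ≤ e^{(θ/400)√n}` eventually. [folklore] -/
private theorem deviation_of_mgf_abstract {α : ℕ → Type*} [∀ n, Fintype (α n)]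
    (Z : ∀ n, α n → ℤ)
    (h : ∃ C : ℝ, ∃ θ₀ : ℝ, 0 < θ₀ ∧ ∀ θ : ℝ, 0 < θ → θ ≤ θ₀ → ∃ n₀ : ℕ, ∀ n ≥ n₀,
      ∑ i : α n, (Real.exp (θ * (Z n i : ℝ) / Real.sqrt (n : ℝ)) +
        Real.exp (-(θ * (Z n i : ℝ) / Real.sqrt (n : ℝ)))) ≤
        2 * (n.factorial : ℝ) * Real.exp (C * θ ^ 2 * Real.sqrt (n : ℝ))) :
    ∃ c : ℝ, 0 < c ∧ ∃ n₀ : ℕ, ∀ n ≥ n₀,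
      (Nat.card {i : α n // (n : ℤ) ≤ 100 * |Z n i|} : ℝ) ≤
        (n.factorial : ℝ) * Real.exp (-(c * Real.sqrt (n : ℝ))) := by
  obtain ⟨C, θ₀, hθ₀, hC⟩ := h
  -- the choice of `θ`: `0 < θ ≤ θ₀` and `C θ² ≤ θ/200`
  set θ : ℝ := min θ₀ (1 / (200 * (|C| + 1))) with hθdef
  have hθpos : 0 < θ := lt_min hθ₀ (by positivity)
  have hθle : θ ≤ θ₀ := min_le_left _ _
  have hθC : C * θ ^ 2 ≤ θ / 200 := by
    have h1 : θ ≤ 1 / (200 * (|C| + 1)) := min_le_right _ _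
    have h3 : |C| * (1 / (200 * (|C| + 1))) ≤ 1 / 200 := by
      rw [mul_one_div, div_le_div_iff₀ (by positivity) (by positivity)]
      nlinarith [abs_nonneg C]
    have h2 : C * θ ≤ 1 / 200 :=
      calc C * θ ≤ |C| * θ := mul_le_mul_of_nonneg_right (le_abs_self C) hθpos.le
        _ ≤ |C| * (1 / (200 * (|C| + 1))) := mul_le_mul_of_nonneg_left h1 (abs_nonneg C)
        _ ≤ 1 / 200 := h3
    calc C * θ ^ 2 = (C * θ) * θ := by ring
      _ ≤ (1 / 200) * θ := mul_le_mul_of_nonneg_right h2 hθpos.le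
      _ = θ / 200 := by ring
  obtain ⟨n₀, hn₀⟩ := hC θ hθpos hθle
  obtain ⟨n₁, hn₁⟩ := exists_two_le_exp (c := θ / 400) (by positivity)
  refine ⟨θ / 400, by positivity, max n₀ n₁, fun n hn => ?_⟩
  obtain ⟨hn₀', hn₁'⟩ : n₀ ≤ n ∧ n₁ ≤ n := by simpa only [ge_iff_le, max_le_iff] using hn
  -- Chernoff: `#{…}·e^{θ√n/100} ≤ 2·n!·e^{Cθ²√n}`
  have hcore := (card_mul_exp_le_sum (Z n) n hθpos).trans (hn₀ n hn₀')
  -- constants: `2·e^{Cθ²√n} ≤ e^{(θ/400)√n}·e^{(θ/200)√n} = e^{-(θ/400)√n}·e^{θ√n/100}`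
  have hA : Real.exp (C * θ ^ 2 * Real.sqrt (n : ℝ)) ≤ Real.exp (θ / 200 * Real.sqrt (n : ℝ)) :=
    Real.exp_le_exp.2 (mul_le_mul_of_nonneg_right hθC (Real.sqrt_nonneg _))
  have hprod : 2 * Real.exp (C * θ ^ 2 * Real.sqrt (n : ℝ)) ≤
      Real.exp (θ / 400 * Real.sqrt (n : ℝ)) * Real.exp (θ / 200 * Real.sqrt (n : ℝ)) :=
    mul_le_mul (hn₁ n hn₁') hA (Real.exp_pos _).le (Real.exp_pos _).le
  have hexp : Real.exp (θ / 400 * Real.sqrt (n : ℝ)) * Real.exp (θ / 200 * Real.sqrt (n : ℝ)) =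
      Real.exp (-(θ / 400 * Real.sqrt (n : ℝ))) * Real.exp (θ * Real.sqrt (n : ℝ) / 100) := by
    rw [← Real.exp_add, ← Real.exp_add]
    congr 1
    ring
  have hf : (0 : ℝ) ≤ (n.factorial : ℝ) := Nat.cast_nonneg _
  have hfin : (Nat.card {i : α n // (n : ℤ) ≤ 100 * |Z n i|} : ℝ) *
        Real.exp (θ * Real.sqrt (n : ℝ) / 100) ≤
      (n.factorial : ℝ) * Real.exp (-(θ / 400 * Real.sqrt (n : ℝ))) *
        Real.exp (θ * Real.sqrt (n : ℝ) / 100) :=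
    calc (Nat.card {i : α n // (n : ℤ) ≤ 100 * |Z n i|} : ℝ) *
          Real.exp (θ * Real.sqrt (n : ℝ) / 100)
          ≤ 2 * (n.factorial : ℝ) * Real.exp (C * θ ^ 2 * Real.sqrt (n : ℝ)) := hcore
      _ = (n.factorial : ℝ) * (2 * Real.exp (C * θ ^ 2 * Real.sqrt (n : ℝ))) := by ring
      _ ≤ (n.factorial : ℝ) * (Real.exp (θ / 400 * Real.sqrt (n : ℝ)) *
            Real.exp (θ / 200 * Real.sqrt (n : ℝ))) := mul_le_mul_of_nonneg_left hprod hf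
      _ = (n.factorial : ℝ) * Real.exp (-(θ / 400 * Real.sqrt (n : ℝ))) *
            Real.exp (θ * Real.sqrt (n : ℝ) / 100) := by rw [hexp, mul_assoc]
  exact le_of_mul_le_mul_right hfin (Real.exp_pos _)

end KlrLine

set_option linter.dupNamespace false in -- deliberate Summit.<S>.<P> duplicate
open KlrLine in
/-- **Stub `pairDeviation_of_mgf` (bridge M of line `klr-graded-polynomial-method`, crux
`SnSubsetDichotomy.NoThresholdSubsetTriple`, stmt-MatrixMultiplication-8302): the MGF form of
J′ implies its two-sided deviation form (Chernoff).** With `X i = deg₂ S + deg₂ T`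
(`TableauPair.degree 2 i`) and `w i = c₀ − (c₀ − c₁)²` the `2`-weight of the shape: if for some
`C`, `θ₀ > 0` and all `0 < θ ≤ θ₀`,
`∑_i (e^{θ(X i − w i)/√n} + e^{−θ(X i − w i)/√n}) ≤ 2·n!·e^{Cθ²√n}` for large `n`, then
`#{i : n ≤ 100·|X i − w i|} ≤ n!·e^{−c√n}` for some `c > 0` and all large `n`. The special case
`Z n i = X i − w i` of the abstract Chernoff bound `deviation_of_mgf_abstract`. [folklore] -/
theorem pairDeviation_of_mgf : (∃ C : ℝ, ∃ θ₀ : ℝ, 0 < θ₀ ∧ ∀ θ : ℝ, 0 < θ → θ ≤ θ₀ → ∃ n₀ : ℕ, ∀ n ≥ n₀, ∑ i : TableauPair n, (Real.exp (θ * ((TableauPair.degree 2 i - ((TableauPair.content 2 i 0 : ℤ) - ((TableauPair.content 2 i 0 : ℤ) - (TableauPair.content 2 i 1 : ℤ)) ^ 2) : ℤ) : ℝ) / Real.sqrt (n : ℝ)) + Real.exp (-(θ * ((TableauPair.degree 2 i - ((TableauPair.content 2 i 0 : ℤ) - ((TableauPair.content 2 i 0 : ℤ) - (TableauPair.content 2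 i 1 : ℤ)) ^ 2) : ℤ) : ℝ) / Real.sqrt (n : ℝ)))) ≤ 2 * (n.factorial : ℝ) * Real.exp (C * θ ^ 2 * Real.sqrt (n : ℝ))) → (∃ c : ℝ, 0 < c ∧ ∃ n₀ : ℕ, ∀ n ≥ n₀, (Nat.card {i : TableauPair n // (n : ℤ) ≤ 100 * |TableauPair.degree 2 i - ((TableauPair.content 2 i 0 : ℤ) - ((TableauPair.content 2 i 0 : ℤ) - (TableauPair.content 2 i 1 : ℤ)) ^ 2)|} : ℝ) ≤ (n.factorial : ℝ) * Real.exp (-(c * Real.sqrt (n : ℝ)))) := by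
  intro h
  exact deviation_of_mgf_abstract (α := TableauPair)
    (fun n (i : TableauPair n) => TableauPair.degree 2 i -
      ((TableauPair.content 2 i 0 : ℤ) -
        ((TableauPair.content 2 i 0 : ℤ) - (TableauPair.content 2 i 1 : ℤ)) ^ 2)) h

end Summit.MatrixMultiplication.MatrixMultiplication.Theorems
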